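import Summits.FinalStateConjecture.FinalStateConjecture.Theorems.PhotonSphereChannelsChannelsResolveTameDevelopmentsRFlatHorizonTransport
import HarnessLib

/-!
# Route PhotonSphereChannels · crux `ChannelsResolveTameDevelopmentsR` (K2R-T2, stmt-FinalStateConjecture-17430) ·
# line `tame-lasalle-dock` · stub D, input (I): the RESIDUE, isolated — (I) for every tame end of every flat spacetime
# follows from ONE statement about far charts of `(ℝ⁴, η)` (slice rigidity / asymptotic inertiality)

After `…RFlatHorizonCriterion` (p164621), `…RFlatHorizonLag` (p165587) and `…RFlatHorizonTransport` (p166475), input (I)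
of the stub-D reduction `dockReadyHull_of_inertial_of_collar_of_full` — `IsMinkowski 𝓢 → 𝓢.blackHoleRegionOfEnd (range E.far) = ∅`
for tame ends `E` — hinges on ONE pure Minkowski-geometry statement, written out here as the HYPOTHESIS `hSR` of
`inertiality_of_sliceRigidity` (no definition is introduced): every smooth injective eternal far chart of Minkowski spacetime
with `far_* ∂₀` future, `0 ≤ M`, `max (2M) 0 < R` and the weighted `C³` far bounds has, at SOME radius `‖y‖ ≥ 4M + 2C` of its
cylinder, chart velocity `dfar_{(t,y)} ∂₀` growing at most linearly in chart time `t ≥ 0` (SLICE RIGIDITY: a tame far slice of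
`ℝ⁴₁` is asymptotic to a hyperplane at a uniform rate, so the frame at one radius is even BOUNDED in `t`; evidence note
G6-LAG-AND-SLICE-RIGIDITY-s64.md). This file proves the glue:

* `h_inertialEnd_funext` — the inertial end `⟨E.M, E.R, E.C, Ψ⁻¹ ∘ E.far, 0⟩` of a flat presentation `Ψ` has the SAME far
  deviation as a FUNCTION on `E4` (on the cylinder by `h_inertialEnd_eq`, off it both vanish), hence the same weighted
  `C^m` far bounds at every order;
* `injective_invFun_comp_far` — its far chart is injective;
* `inertiality_of_sliceRigidity` (registered sub-goal): `hSR` ⇒ for every spacetime `𝓢` with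
  `IsMinkowski 𝓢` and every `E.IsTameEnd Λ r₀`, `E.horizon = ∅ ∧ 𝓢.blackHoleRegionOfEnd (range E.far) = ∅` — apply `hSR`
  to the inertial end and feed the bound to `flatHorizonTransport`.

So the lead can register exactly `hSR` as the residue of (I); nothing else of (G6)/(I) is open. No route item is restated.

References: O'Neill 1983, Ch. 3, pp. 90–91; Ch. 14, pp. 402–403 [ONeill1983]; Wald 1984, §12.1 [Wald1984];
Bartnik 1984 (interior estimates for spacelike hypersurfaces of Minkowski space) [Bartnik1984].
-/

noncomputable section

set_option maxSynthPendingDepth 3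
set_option linter.dupNamespace false

open Set Filter Function TopologicalSpace Manifold Bundle
open scoped Topology Manifold ContDiff ENNReal NNReal

namespace Summit.FinalStateConjecture.FinalStateConjecture.Theorems.TameLaSalle.FlatHorizon

open Literature.Geometry.Lorentzian
open Summit.FinalStateConjecture.FinalStateConjecture.Theorems.TameHull

variable {𝓢 : Spacetime.{0} 4} {Ψ : E4 → 𝓢.carrier}

/-- **The inertial end has the same far deviation as a function on `E4`** (so the same weighted `C^m` far bounds at every
order): on the far cylinder by `h_inertialEnd_eq`, and off the cylinder both zero-extensions vanish
(`deviationExtend_of_not_mem`). O'Neill 1983, Ch. 3, pp. 90–91. [cite: ONeill1983, Ch. 3, pp. 90–91] -/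
theorem h_inertialEnd_funext (E : EndDatum 𝓢) (hΨ : Function.Bijective Ψ) (hsm : ContMDiff 𝓘(ℝ, E4) (𝓡 4) ∞ Ψ)
    (hdev : ∀ x, 𝓢.minkowskiDeviation Ψ x = 0) (hfar : ContMDiff 𝓘(ℝ, E4) (𝓡 4) ∞ E.far) :
    (⟨E.M, E.R, E.C, Function.invFun Ψ ∘ E.far, fun _ ↦ 0⟩ : EndDatum Minkowski.spacetime).h = E.h := by
  funext z
  by_cases hz : z ∈ Kerr.region (0 : ℝ) E.R
  · exact h_inertialEnd_eq E hΨ hsm hdev hfar ⟨z, hz⟩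
  · change Minkowski.spacetime.deviationExtend (farBackground E.M E.R) (Function.invFun Ψ ∘ E.far) z =
      𝓢.deviationExtend (farBackground E.M E.R) E.far z
    rw [Spacetime.deviationExtend_of_not_mem _ _ _ hz, Spacetime.deviationExtend_of_not_mem _ _ _ hz]

/-- **The inertial reading of an injective far chart is injective** (`Ψ⁻¹` is injective, being a two-sided inverse of the
bijection `Ψ`). [folklore] -/
theorem injective_invFun_comp_far (E : EndDatum 𝓢) (hΨ : Function.Bijective Ψ) (hinj : Function.Injective E.far) :
    Function.Injective (Function.invFun Ψ ∘ E.far) :=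
  (Function.rightInverse_invFun hΨ.2).injective.comp hinj

/-- **Input (I) of stub D for every tame end of every flat spacetime, from SLICE RIGIDITY of far charts of `(ℝ⁴, η)`
(registered sub-goal `inertiality_of_sliceRigidity` of stmt-FinalStateConjecture-17430).** Hypothesis `hSR` (the residue, written out):
every smooth injective eternal far chart of Minkowski spacetime with `far_* ∂₀` future-directed, `0 ≤ M`, `max (2M) 0 < R` and
`‖D^m h‖ · r ≤ C` for `m ≤ 3` admits a radius `‖y‖ ≥ 4M + 2C` in its cylinder and `K > 0` with `‖dfar_{(t,y)} ∂₀‖ ≤ K (1 + t)`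
for `t ≥ 0`. Conclusion: for every spacetime `𝓢` presented as Minkowski space (`IsMinkowski 𝓢`) and every `(Λ, r₀)`-tame end
`E` of `𝓢`, `E.horizon = ∅` and `𝓢.blackHoleRegionOfEnd (range E.far) = ∅`. Proof: the inertial end `Ψ⁻¹ ∘ E.far` of
`(ℝ⁴, η, ∂ₜ)` is smooth (`contMDiff_invFun_comp_far`), injective, has future `∂₀` (`isFutureDirected_mfderiv_inertialFar`)
and the same `h` (`h_inertialEnd_funext`), so `hSR` applies to it; `flatHorizonTransport` concludes. Wald 1984, §12.1.
[cite: Wald1984, §12.1] -/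
theorem inertiality_of_sliceRigidity : (∀ (F : EndDatum Minkowski.spacetime), ContMDiff 𝓘(ℝ, E4) (𝓡 4) ∞ F.far → Function.Injective F.far → (∀ x : Kerr.region (0 : ℝ) F.R, Minkowski.spacetime.timeOrientation.IsFutureDirected (mfderiv 𝓘(ℝ, E4) (𝓡 4) F.far x (E4.basisVector 0))) → 0 ≤ F.M → max (2 * F.M) 0 < F.R → (∀ m ≤ 3, ∀ x : Kerr.region (0 : ℝ) F.R, ‖iteratedFDeriv ℝ m F.h x.1‖ * Kerr.radius 0 x.1 ≤ F.C) → ∃ (y : E3) (K : ℝ), max F.R 0 < ‖y‖ ∧ 4 * F.M + 2 * F.C ≤ ‖y‖ ∧ 0 < K ∧ ∀ x : Kerr.region (0 : ℝ) F.R, E4.spatial x.1 = y → 0 ≤ x.1 0 → ‖(id (mfderiv 𝓘(ℝ, E4) (𝓡 4) F.far x (E4.basisVector 0)) : E4)‖ ≤ K * (1 + x.1 0)) → ∀ {𝓢 : Spacetime.{0} 4} (E : EndDatum 𝓢) (Λ : ℝ≥0) (r₀ : ℝ), IsMinkowski 𝓢 → E.IsTameEnd Λ r₀ → E.horizon = ∅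 ∧ 𝓢.blackHoleRegionOfEnd (Set.range E.far) = ∅ := by
  intro hSR 𝓢 E Λ r₀ hflat hE
  obtain ⟨Ψ, hΨ, hsm, hdev, hfut⟩ := hflat
  have hfar : ContMDiff 𝓘(ℝ, E4) (𝓡 4) ∞ E.far := hE.far_isLocalDiffeomorph.contMDiff
  -- the inertial end of Minkowski spacetime and its data
  set F : EndDatum Minkowski.spacetime := ⟨E.M, E.R, E.C, Function.invFun Ψ ∘ E.far, fun _ ↦ 0⟩ with hF
  have hFfar : ContMDiff 𝓘(ℝ, E4) (𝓡 4) ∞ F.far := contMDiff_invFun_comp_far E hΨ hsm hdev hfar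
  have hFinj : Function.Injective F.far := injective_invFun_comp_far E hΨ hE.far_injective
  have hFfut : ∀ x : Kerr.region (0 : ℝ) F.R, Minkowski.spacetime.timeOrientation.IsFutureDirected
      (mfderiv 𝓘(ℝ, E4) (𝓡 4) F.far x (E4.basisVector 0)) :=
    fun x ↦ isFutureDirected_mfderiv_inertialFar E hΨ hsm hdev hfut hfar hE.far_future x
  have hFh : F.h = E.h := h_inertialEnd_funext E hΨ hsm hdev hfar
  have hFbound : ∀ m ≤ 3, ∀ x : Kerr.region (0 : ℝ) F.R, ‖iteratedFDeriv ℝ m F.h x.1‖ * Kerr.radius 0 x.1 ≤ F.C :=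
    fun m hm x ↦ by
    rw [hFh]
    exact hE.far_bound m hm x
  obtain ⟨y, K, hy, hyC, hK, hgr⟩ := hSR F hFfar hFinj hFfut hE.mass_nonneg hE.lt_R hFbound
  exact flatHorizonTransport E Ψ hΨ hsm hdev hfut Λ r₀ hE y hy hyC K hK hgr

end Summit.FinalStateConjecture.FinalStateConjecture.Theorems.TameLaSalle.FlatHorizon

end
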